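import Mathlib
import HarnessLib.Audit
import Summits.PneNP.PneNP.Theorems.PstarCleanChordCount

/-!
# Slice genericity of a clean chord only depends on the INTERNAL menu (ROUND-24, O1; memo g23 §28)

FRONTIER range-avoidance ladder, rung F-N3, ROUND 24 (cell `pnp-ideate`, prover-2 memo `g23/O1-TWOCLEAN-g23.md` §28; typed target
`PstarCoreBoundTargets.TerminalPeelable` (p646951); restricted-model proof complexity — nothing here bears on `P` versus `NP`).

`SliceGeneric I y J₀ c 𝒢` (`PstarChordReadLemma`) quantifies over readers drawing monomials from the whole menu `𝒢 = G₁ ∪ G₂`, outside gates `{private, z}`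
included.  For an OUTSIDE-GATED chord `c` this is no stronger than genericity for the INTERNAL menu `𝒢ᵢ` — the monomials of `𝒢` with both AND
variables among the variables of `J₀`, i.e. not `outside` (σσ′ couplings, σπ, cross pairs):

* **`sliceGeneric_of_internal`**: `OutsideGated I J₀ 𝒢 c` and `SliceGeneric I y J₀ c 𝒢ᵢ` ⟹ `SliceGeneric I y J₀ c 𝒢`.
  Proof.  A reader `(C, G ⊆ 𝒢)` missing `b` on the slice `H_t` has NO gate on the privates of `c` (the private and the gate partner are both free on
  `H_t`: set the partners so that flipping the private flips the reader).  Then every restriction `Γ|_w` to a fibre of the outside variables is an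
  internal reader avoiding the privates and missing a value on `H_t`, hence a function `φ_w` of `s = x_a ⊕ x_b` (internal genericity); so on each fibre
  `Γ` is a function of `s`, equal to `¬b` where `s = t` and to `¬b ⊕ [a ∈ C]` where `s ≠ t` (flip `a`) — the same function on every fibre.
* `sliceGeneric_of_internal_criterion` — hence `NoPathSumSubcore` and `NoShortCoincidence` for the INTERNAL menu suffice (the sub-core readers `d₂`
  of branch (A) draw their menu monomials from internal couplings and folds only — no outside gates), and the O1 nodes shrink accordingly:
  `CleanCriterionBoundInt → TerminalPeelable` (`terminalPeelable_of_boundInt`).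

No Assumption A.
-/

set_option linter.dupNamespace false -- `Summit.PneNP.PneNP.…`: summit = sub-problem name (D-0017 single-conjunct layout)

open Finset Literature.Computability.Complexity
open Summit.PneNP.PneNP.Theorems.PstarFibrePolys (bit bit_injective)
open Summit.PneNP.PneNP.Theorems.PstarTyped (Typed)
open Summit.PneNP.PneNP.Theorems.PstarSALevel (varSet bdry BoundaryExpanding SimpleOverlap)
open Summit.PneNP.PneNP.Theorems.PstarXCore (xverts)
open Summit.PneNP.PneNP.Theorems.PstarGapPeeling (not_mem_varSet_of_private eval_update_of_not_mem)
open Summit.PneNP.PneNP.Theorems.PstarCentreFree (vars_mem_varSet)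
open Summit.PneNP.PneNP.Theorems.PstarGapOneAll (gval)
open Summit.PneNP.PneNP.Theorems.PstarGConstraint (bit_gval)
open Summit.PneNP.PneNP.Theorems.PstarChordRepair (IsChord)
open Summit.PneNP.PneNP.Theorems.PstarCoreBoundTargets (Terminal TerminalPeelable)
open Summit.PneNP.PneNP.Theorems.PstarSharingBound (sharedSlots)
open Summit.PneNP.PneNP.Theorems.PstarChordBridgeTools (xpdeg)
open Summit.PneNP.PneNP.Theorems.PstarGSat (gSat)
open Summit.PneNP.PneNP.Theorems.PstarChordReadsMirror (gval_pair)
open Summit.PneNP.PneNP.Theorems.PstarChordReadLemma (SliceGeneric)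
open Summit.PneNP.PneNP.Theorems.PstarChordReadSwitches (Touches)
open Summit.PneNP.PneNP.Theorems.PstarChordReadFlip (mv gval_flip)
open Summit.PneNP.PneNP.Theorems.PstarChordReadOutside (partners mem_partners_iff mv_eq_partners IsGate OutsideGated)
open Summit.PneNP.PneNP.Theorems.PstarChordReadOutsideKill (avoids_of_not_touches)
open Summit.PneNP.PneNP.Theorems.PstarChordReadRestrictVar (restrictL constL overrideL gval_restrictL restrictL_snd_subset overrideL_eq_self)
open Summit.PneNP.PneNP.Theorems.PstarChordReadNor (fibreList mem_fibreList overrideL_fibreList_of_mem overrideL_fibreList_of_not_mem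
  overrideL_fibreList_self solves_overrideL_fibreList gval_lin_congr)
open Summit.PneNP.PneNP.Theorems.PstarChordReadFibre (outside mem_outside not_mem_outside_of_mem restrictL_snd_avoid mem_restrictL_fst_iff
  mv_of_no_monomial partners_subset_outside)
open Summit.PneNP.PneNP.Theorems.PstarSliceGenericCriterion (NoPathSumSubcore NoShortCoincidence sliceGeneric_of_criterion)
open Summit.PneNP.PneNP.Theorems.PstarCleanChordCount (exists_clean_chords)
open Summit.PneNP.PneNP.Theorems.PstarChordReadTwoClean (false_of_two_clean)
open Summit.PneNP.PneNP.Theorems.PstarTerminalPeelableTwelve (exists_centre_of_not_peelable)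

namespace Summit.PneNP.PneNP.Theorems.PstarSliceGenericInternal

variable {n m : ℕ}

/-- The **INTERNAL MENU** of `𝒢` for the family `J₀`: the monomial outputs with both AND variables among the variables of `J₀` (neither is
`outside`). -/
def internalMenu (I : LocalMap 4 n m) (J₀ 𝒢 : Finset (Fin m)) : Finset (Fin m) :=
  𝒢.filter fun g => I.vars g 2 ∉ outside I J₀ ∧ I.vars g 3 ∉ outside I J₀

/-- Membership in the internal menu. -/
theorem mem_internalMenu (I : LocalMap 4 n m) {J₀ 𝒢 : Finset (Fin m)} {g : Fin m} :
    g ∈ internalMenu I J₀ 𝒢 ↔ g ∈ 𝒢 ∧ I.vars g 2 ∉ outside I J₀ ∧ I.vars g 3 ∉ outside I J₀ := by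
  unfold internalMenu; rw [mem_filter]

/-- The internal menu is part of the menu. -/
theorem internalMenu_subset (I : LocalMap 4 n m) (J₀ 𝒢 : Finset (Fin m)) : internalMenu I J₀ 𝒢 ⊆ 𝒢 := by
  unfold internalMenu; exact filter_subset _ _

variable {I : LocalMap 4 n m} {r : ℕ} {y : Fin m → Bool} {J₀ 𝒢 : Finset (Fin m)} {c : Fin m}

/-- The linear G-constraint of a set `P` at the indicator of one of its elements is `true`. -/
theorem gval_lin_indicator (I : LocalMap 4 n m) {P : Finset (Fin n)} {z : Fin n} (hz : z ∈ P) :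
    gval I P ∅ (fun u => decide (u = z)) = true := by
  classical
  apply bit_injective
  rw [bit_gval, sum_empty, add_zero]
  have h : ∀ u ∈ P, bit (decide (u = z)) = if u = z then (1 : ZMod 2) else 0 := by
    intro u _; by_cases hu : u = z
    · rw [hu]; simp [bit]
    · simp [bit, hu]
  rw [sum_congr rfl h, sum_ite_eq' P z, if_pos hz]
  rfl

/-- **A reader missing a value on a slice of an outside-gated chord has no monomial on the chord's AND pair.**  (The private and its gate partners
are free on the slice.) -/
theorem avoids_of_fail_slice (hI : I.IsPure xorAndPred) (hS : SimpleOverlap I) (hc : c ∈ J₀) (hch : IsChord I J₀ c)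
    (hO : OutsideGated I J₀ 𝒢 c) {C : Finset (Fin n)} {G : Finset (Fin m)} {t b : Bool} (hp : I.vars c 2 ∉ C) (hq : I.vars c 3 ∉ C)
    (hG : G ⊆ 𝒢) (hne : ∃ x : Fin n → Bool, (∀ j ∈ J₀.erase c, I.eval x j = y j) ∧ xor (x (I.vars c 0)) (x (I.vars c 1)) = t)
    (hfail : ∀ x : Fin n → Bool, (∀ j ∈ J₀.erase c, I.eval x j = y j) → xor (x (I.vars c 0)) (x (I.vars c 1)) = t → gval I C G x ≠ b) :
    ∀ g ∈ G, (I.vars g 2 ≠ I.vars c 2 ∧ I.vars g 3 ≠ I.vars c 2) ∧ (I.vars g 2 ≠ I.vars c 3 ∧ I.vars g 3 ≠ I.vars c 3) := by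
  classical
  intro g hg
  refine avoids_of_not_touches fun htouch => ?_
  obtain ⟨v, z, hGate⟩ := hO g (hG hg) htouch
  obtain ⟨x₀, hx₀, hs₀⟩ := hne
  set Z := outside I J₀ with hZ
  have hZout : ∀ u ∈ Z, ∀ j ∈ J₀.erase c, u ∉ varSet I j := fun u hu j hj => (mem_outside I).1 hu j (mem_of_mem_erase hj)
  have hv : v = I.vars c 2 ∨ v = I.vars c 3 := hGate.1
  have hvC : v ∉ C := by rcases hv with e | e <;> rw [e]; exacts [hp, hq]
  have hzP : z ∈ partners I G v := (mem_partners_iff I hI).2 ⟨g, hg, hGate.2.1⟩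
  have hPZ : ∀ u ∈ partners I G v, u ∈ Z := partners_subset_outside hI hO hc hG hv
  have ha : I.vars c 0 ∉ Z := not_mem_outside_of_mem I hc (vars_mem_varSet I c 0)
  have hb : I.vars c 1 ∉ Z := not_mem_outside_of_mem I hc (vars_mem_varSet I c 1)
  have hv0 : v ≠ I.vars c 0 := by
    rcases hv with e | e <;> rw [e] <;> exact fun h => absurd (hI.2 c h) (by decide)
  have hv1 : v ≠ I.vars c 1 := by
    rcases hv with e | e <;> rw [e] <;> exact fun h => absurd (hI.2 c h) (by decide)
  have hvbd : v ∈ bdry I J₀ := by rcases hv with e | e <;> rw [e]; exacts [hch.1, hch.2]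
  have hvc : v ∈ varSet I c := by rcases hv with e | e <;> rw [e]; exacts [vars_mem_varSet I c 2, vars_mem_varSet I c 3]
  -- set the outside variables to the indicator of `z`
  set w : Fin n → Bool := fun u => decide (u = z) with hw
  set x₁ := overrideL x₀ (fibreList Z w) with hx₁
  have hx₁s : ∀ j ∈ J₀.erase c, I.eval x₁ j = y j := solves_overrideL_fibreList I hZout w hx₀
  have hx₁t : xor (x₁ (I.vars c 0)) (x₁ (I.vars c 1)) = t := by
    rw [hx₁, overrideL_fibreList_of_not_mem w x₀ ha, overrideL_fibreList_of_not_mem w x₀ hb]; exact hs₀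
  have hmv : mv I C G v x₁ = true := by
    rw [mv_eq_partners I hI hS, decide_eq_false hvC, Bool.false_xor,
      gval_lin_congr I _ (fun u hu => by rw [hx₁, overrideL_fibreList_of_mem w x₀ (hPZ u hu)]), gval_lin_indicator I hzP]
  -- flip the private
  set x₂ := Function.update x₁ v (!x₁ v) with hx₂
  have hx₂s : ∀ j ∈ J₀.erase c, I.eval x₂ j = y j := fun j hj => by
    rw [hx₂, eval_update_of_not_mem I j x₁ (not_mem_varSet_of_private I hc (mem_of_mem_erase hj) (ne_of_mem_erase hj) hvbd hvc)]
    exact hx₁s j hj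
  have hx₂t : xor (x₂ (I.vars c 0)) (x₂ (I.vars c 1)) = t := by
    rw [hx₂, Function.update_of_ne hv0.symm, Function.update_of_ne hv1.symm]; exact hx₁t
  have e := gval_flip I C G hI x₁ v
  rw [hmv] at e
  have h₁ := hfail x₁ hx₁s hx₁t
  have h₂ := hfail x₂ hx₂s hx₂t
  rw [hx₂, e] at h₂
  revert h₁ h₂; cases gval I C G x₁ <;> cases b <;> decide

/-- **SLICE GENERICITY OF AN OUTSIDE-GATED CHORD ONLY DEPENDS ON THE INTERNAL MENU.** -/
theorem sliceGeneric_of_internal (hI : I.IsPure xorAndPred) (hT : Typed I) (hS : SimpleOverlap I) (hB : BoundaryExpanding r I)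
    (hJr : J₀.card ≤ r) (hc : c ∈ J₀) (hch : IsChord I J₀ c) (hO : OutsideGated I J₀ 𝒢 c)
    (hgen : SliceGeneric I y J₀ c (internalMenu I J₀ 𝒢)) : SliceGeneric I y J₀ c 𝒢 := by
  classical
  intro C G t b hp hq hG hfail
  have h01 : I.vars c 0 ≠ I.vars c 1 := fun h => absurd (hI.2 c h) (by decide)
  set Z := outside I J₀ with hZ
  have hZout : ∀ u ∈ Z, ∀ j ∈ J₀.erase c, u ∉ varSet I j := fun u hu j hj => (mem_outside I).1 hu j (mem_of_mem_erase hj)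
  have ha : I.vars c 0 ∉ Z := not_mem_outside_of_mem I hc (vars_mem_varSet I c 0)
  have hb : I.vars c 1 ∉ Z := not_mem_outside_of_mem I hc (vars_mem_varSet I c 1)
  have hpZ : I.vars c 2 ∉ Z := not_mem_outside_of_mem I hc (vars_mem_varSet I c 2)
  have hqZ : I.vars c 3 ∉ Z := not_mem_outside_of_mem I hc (vars_mem_varSet I c 3)
  -- the slice is non-empty
  obtain ⟨x₀, hx₀, hs₀⟩ : ∃ x : Fin n → Bool, (∀ j ∈ J₀.erase c, I.eval x j = y j) ∧ xor (x (I.vars c 0)) (x (I.vars c 1)) = t := by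
    have hnc : ∃ u u' : Fin n → Bool, gval I {I.vars c 0, I.vars c 1} ∅ u ≠ gval I {I.vars c 0, I.vars c 1} ∅ u' := by
      refine ⟨fun v => decide (v = I.vars c 0), fun _ => false, ?_⟩
      rw [gval_pair I h01, gval_pair I h01]
      simp [h01.symm]
    obtain ⟨x, hx, hxab⟩ := gSat n m r I hI hT hB hS y (J₀.erase c) ∅ {I.vars c 0, I.vars c 1} t ((card_le_card (erase_subset c J₀)).trans hJr)
      (disjoint_empty_right _) hnc
    rw [gval_pair I h01] at hxab
    exact ⟨x, hx, hxab⟩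
  -- no gate on the privates
  have havoid := avoids_of_fail_slice hI hS hc hch hO hp hq hG ⟨x₀, hx₀, hs₀⟩ hfail
  have hGp : ∀ g ∈ G, I.vars g 2 ≠ I.vars c 2 ∧ I.vars g 3 ≠ I.vars c 2 := fun g hg => (havoid g hg).1
  have hGq : ∀ g ∈ G, I.vars g 2 ≠ I.vars c 3 ∧ I.vars g 3 ≠ I.vars c 3 := fun g hg => (havoid g hg).2
  have hGa : ∀ g ∈ G, I.vars g 2 ≠ I.vars c 0 ∧ I.vars g 3 ≠ I.vars c 0 :=
    fun g _ => ⟨(hT c g 0 2 (by decide) (by decide)).symm, (hT c g 0 3 (by decide) (by decide)).symm⟩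
  -- on every fibre the reader is a function of `s`
  have fibre : ∀ w : Fin n → Bool, ∃ φ : Bool → Bool, ∀ x : Fin n → Bool,
      gval I C G (overrideL x (fibreList Z w)) = φ (xor (x (I.vars c 0)) (x (I.vars c 1))) := by
    intro w
    set L := fibreList Z w with hL
    set R := restrictL I C G L with hR
    have keys : ∀ {u : Fin n}, u ∉ Z → ∀ p ∈ L, p.1 ≠ u := fun hu p hp e => hu (e ▸ (mem_fibreList.1 hp).1)
    have hRp : I.vars c 2 ∉ R.1 := (mem_restrictL_fst_iff I hI C G hGp L (keys hpZ)).not.2 hp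
    have hRq : I.vars c 3 ∉ R.1 := (mem_restrictL_fst_iff I hI C G hGq L (keys hqZ)).not.2 hq
    have hRint : R.2 ⊆ internalMenu I J₀ 𝒢 := by
      intro g hg
      have hgG : g ∈ G := restrictL_snd_subset I C G L hg
      have hav := restrictL_snd_avoid I C G L g hg
      refine (mem_internalMenu I).2 ⟨hG hgG, fun h2 => ?_, fun h3 => ?_⟩
      · exact (hav (I.vars g 2, w (I.vars g 2)) (mem_fibreList.2 ⟨h2, rfl⟩)).1 rfl
      · exact (hav (I.vars g 3, w (I.vars g 3)) (mem_fibreList.2 ⟨h3, rfl⟩)).2 rfl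
    have hRfail : ∀ x : Fin n → Bool, (∀ j ∈ J₀.erase c, I.eval x j = y j) → xor (x (I.vars c 0)) (x (I.vars c 1)) = t →
        gval I R.1 R.2 x ≠ xor b (constL I C G L) := by
      intro x hx hs h
      rw [hR, gval_restrictL I hI hS] at h
      have hx' := solves_overrideL_fibreList I hZout w hx
      have hs' : xor (overrideL x L (I.vars c 0)) (overrideL x L (I.vars c 1)) = t := by
        rw [hL, overrideL_fibreList_of_not_mem w x ha, overrideL_fibreList_of_not_mem w x hb]; exact hs
      have hne := hfail _ hx' hs'
      revert h hne; cases gval I C G (overrideL x L) <;> cases b <;> cases constL I C G L <;> decide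
    obtain ⟨φ, hφ⟩ := hgen R.1 R.2 t (xor b (constL I C G L)) hRp hRq hRint hRfail
    refine ⟨fun s => xor (φ s) (constL I C G L), fun x => ?_⟩
    have h := hφ x
    rw [hR, gval_restrictL I hI hS] at h
    show gval I C G (overrideL x L) = xor (φ (xor (x (I.vars c 0)) (x (I.vars c 1)))) (constL I C G L)
    revert h
    generalize φ (xor (x (I.vars c 0)) (x (I.vars c 1))) = u
    cases gval I C G (overrideL x L) <;> cases u <;> cases constL I C G L <;> decide
  -- the value where `s = t` is `¬ b`, on every fibre
  have on_t : ∀ x : Fin n → Bool, xor (x (I.vars c 0)) (x (I.vars c 1)) = t → gval I C G x = !b := by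
    intro x hs
    obtain ⟨φ, hφ⟩ := fibre x
    have h₁ := hφ x
    rw [overrideL_fibreList_self] at h₁
    set x' := overrideL x₀ (fibreList Z x) with hx'
    have hx's : ∀ j ∈ J₀.erase c, I.eval x' j = y j := solves_overrideL_fibreList I hZout x hx₀
    have hx't : xor (x' (I.vars c 0)) (x' (I.vars c 1)) = t := by
      rw [hx', overrideL_fibreList_of_not_mem x x₀ ha, overrideL_fibreList_of_not_mem x x₀ hb]; exact hs₀
    have h₂ := hφ x₀
    rw [hs₀] at h₂
    have hne := hfail x' hx's hx't
    rw [h₁, hs, ← h₂]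
    revert hne; cases gval I C G (overrideL x₀ (fibreList Z x)) <;> cases b <;> decide
  -- the value where `s ≠ t`: flip `a`
  refine ⟨fun s => if s = t then !b else xor (!b) (decide (I.vars c 0 ∈ C)), fun x => ?_⟩
  by_cases hs : xor (x (I.vars c 0)) (x (I.vars c 1)) = t
  · show gval I C G x = if xor (x (I.vars c 0)) (x (I.vars c 1)) = t then !b else xor (!b) (decide (I.vars c 0 ∈ C))
    rw [if_pos hs]; exact on_t x hs
  · show gval I C G x = if xor (x (I.vars c 0)) (x (I.vars c 1)) = t then !b else xor (!b) (decide (I.vars c 0 ∈ C))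
    rw [if_neg hs]
    set x' := Function.update x (I.vars c 0) (!x (I.vars c 0)) with hx'
    have hs' : xor (x' (I.vars c 0)) (x' (I.vars c 1)) = t := by
      rw [hx', Function.update_self, Function.update_of_ne h01.symm]
      revert hs; cases x (I.vars c 0) <;> cases x (I.vars c 1) <;> cases t <;> decide
    have e := gval_flip I C G hI x (I.vars c 0)
    rw [mv_of_no_monomial I C G hGa] at e
    have h' := on_t x' hs'
    rw [hx', e] at h'
    revert h'; cases gval I C G x <;> cases b <;> cases decide (I.vars c 0 ∈ C) <;> decide

/-- **The criterion for the INTERNAL menu suffices** for an outside-gated chord. -/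
theorem sliceGeneric_of_internal_criterion (hI : I.IsPure xorAndPred) (hT : Typed I) (hS : SimpleOverlap I) (hB : BoundaryExpanding r I)
    (hc : c ∈ J₀) (hch : IsChord I J₀ c) (hO : OutsideGated I J₀ 𝒢 c) (hdisj : Disjoint J₀ 𝒢) (hr : (J₀ ∪ 𝒢).card ≤ r)
    (hA : NoPathSumSubcore I r y J₀ c (internalMenu I J₀ 𝒢)) (hBc : NoShortCoincidence I J₀ c (internalMenu I J₀ 𝒢)) :
    SliceGeneric I y J₀ c 𝒢 :=
  sliceGeneric_of_internal hI hT hS hB ((card_le_card subset_union_left).trans hr) hc hch hO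
    (sliceGeneric_of_criterion hI hT hS hB hc (hdisj.mono_right (internalMenu_subset I J₀ 𝒢))
      ((card_le_card (union_subset_union (Subset.refl _) (internalMenu_subset I J₀ 𝒢))).trans hr) hA hBc)

/-! ## The O1 node for internal menus -/

/-- **`CleanCriterionBoundInt` (OPEN): on every centre structure, all but at most `#sharedSlots − 2` clean chords pass the criterion FOR THE INTERNAL
MENU.**  As `PstarCleanChordCount.CleanCriterionBound`, with `NoPathSumSubcore` / `NoShortCoincidence` taken for `internalMenu I J₀ (G₁ ∪ G₂)`: the
sub-core readers of branch (A) use internal couplings and folds only, no outside gates.  FRONTIER. -/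
@[conjecture] def CleanCriterionBoundInt : Prop :=
  ∀ (n m r : ℕ) (I : LocalMap 4 n m), I.IsPure xorAndPred → Typed I → SimpleOverlap I → BoundaryExpanding r I →
    ∀ (y : Fin m → Bool) (J₀ : Finset (Fin m)) (w₁ w₂ : Finset (Fin n) × Finset (Fin m) × Bool), Terminal I r y J₀ w₁ w₂ →
      (∃ S ⊆ J₀, S.Nonempty ∧ (∀ w ∈ xverts I S, 2 ≤ xpdeg I S w) ∧ ∀ f ∈ S, ¬ IsChord I J₀ f) →
      ∃ ℬ ⊆ J₀, ℬ.card + 2 ≤ (sharedSlots I J₀).card ∧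
        ∀ c ∈ J₀, c ∉ ℬ → IsChord I J₀ c → OutsideGated I J₀ (w₁.2.1 ∪ w₂.2.1) c →
          NoPathSumSubcore I r y J₀ c (internalMenu I J₀ (w₁.2.1 ∪ w₂.2.1)) ∧ NoShortCoincidence I J₀ c (internalMenu I J₀ (w₁.2.1 ∪ w₂.2.1))

/-- **O1 FROM THE INTERNAL-MENU FAILURE BOUND.** -/
theorem terminalPeelable_of_boundInt (h : CleanCriterionBoundInt) : TerminalPeelable := by
  classical
  intro n m r I hI hT hS hB y J₀ w₁ w₂ ht
  by_contra hnp
  obtain ⟨S, hSJ, hne, hL, hnc⟩ := exists_centre_of_not_peelable I hnp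
  obtain ⟨ℬ, -, hℬ, hgood⟩ := h n m r I hI hT hS hB y J₀ w₁ w₂ ht ⟨S, hSJ, hne, hL, hnc⟩
  obtain ⟨𝒞, h𝒞J, hch, hO, hcard⟩ := exists_clean_chords hB ht
  have hU : 1 < (𝒞 \ ℬ).card := by
    have := le_card_sdiff ℬ 𝒞
    omega
  obtain ⟨a, ha, b, hb, hab⟩ := one_lt_card.1 hU
  obtain ⟨ha𝒞, haℬ⟩ := mem_sdiff.1 ha
  obtain ⟨hb𝒞, hbℬ⟩ := mem_sdiff.1 hb
  obtain ⟨hAa, hBa⟩ := hgood a (h𝒞J ha𝒞) haℬ (hch a ha𝒞) (hO a ha𝒞)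
  obtain ⟨hAb, hBb⟩ := hgood b (h𝒞J hb𝒞) hbℬ (hch b hb𝒞) (hO b hb𝒞)
  have hdisj : Disjoint J₀ (w₁.2.1 ∪ w₂.2.1) := disjoint_union_right.2 ⟨ht.2.2.2.1, ht.2.2.2.2.1⟩
  have hr : (J₀ ∪ (w₁.2.1 ∪ w₂.2.1)).card ≤ r := by rw [← union_assoc]; exact ht.2.2.2.2.2.1
  exact false_of_two_clean hI hT hS hB ht (h𝒞J ha𝒞) (h𝒞J hb𝒞) hab (hch a ha𝒞) (hch b hb𝒞) (hO a ha𝒞) (hO b hb𝒞)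
    (sliceGeneric_of_internal_criterion hI hT hS hB (h𝒞J ha𝒞) (hch a ha𝒞) (hO a ha𝒞) hdisj hr hAa hBa)
    (sliceGeneric_of_internal_criterion hI hT hS hB (h𝒞J hb𝒞) (hch b hb𝒞) (hO b hb𝒞) hdisj hr hAb hBb)

end Summit.PneNP.PneNP.Theorems.PstarSliceGenericInternal
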